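import Summits.QuantumFields.YangMills.Theses.SqueezedSkewness
import Summits.QuantumFields.YangMills.Theorems.ThermalDescentShortCentring
import Summits.QuantumFields.YangMills.Theorems.ThermalDescentSpectralBounds
import Summits.QuantumFields.YangMills.Theorems.ThermalDescentPeriodDescentGlue
import HarnessLib

/-!
# Route `SqueezedSkewness`, shared crux `PeriodDescent` (stmt-QuantumFields-26517): the registered stubs `stub_centring` and
# `stub_spectral` of the birth skeleton `Cruxes/NT/Lines/thermal_descent_period_birth.lean` BY NAME AND SIGNATURE

The BC3 birth skeleton of `PeriodDescent` (planner ym-idea-6 g3, @255844ca2b92) registers three stubs on item 26517: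
`stub_hsTransfer` (L, load-bearing), `stub_centring` (M), `stub_spectral` (S/M).  Their statements are CHARACTER-IDENTICAL to the three
children of the (since closed) route `ThermalDescent`'s split of the same item — `HsTransfer` (27307), `ShortCentring` (27308),
`SpectralBounds` (27309) — and the latter two are PROVED in the tree (`ThermalDescentReflection.thermalDescent_shortCentring`, p-landed with
the reflection-invariance kit `ThermalDescentShortCentring.lean`; `thermalDescent_spectralBounds`).  This file re-serves those two proofs under
the registered stub names (so the stub registry of 26517, which the live route `SqueezedSkewness` wants, records them as landed) and packages
`PeriodDescent ⇐ HsTransfer` for both route copies via the proved glue `thermalDescent_periodDescentGlue`.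

Seat `ym-line-fcl-p3` g14 (cell ym-idea-1; free hands).  THEOREMS ONLY; no new mathematics (bookkeeping over landed proofs).  HONEST FRAMING:
`stub_hsTransfer` (the short-centred Hilbert–Schmidt transfer inequality, L) is NOT proved; no crux, NT statement or mass gap is proved.
-/

set_option autoImplicit false

namespace Summit.QuantumFields.YangMills.Theorems.SqueezedSkewnessPeriodDescentStubs

set_option linter.unusedVariables false in
/-- **Registered stub `stub_centring` of crux 26517 (M)**: `E_P'[(θB − ⟨B⟩_P)(B − ⟨B⟩_P)] = Cov_P'(θB, B) + (⟨B⟩_P' − ⟨B⟩_P)²` — reflection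
invariance of the torus state + bilinearity; = `ThermalDescent.ShortCentring` (27308) verbatim, proved in the tree.
[cite: OsterwalderSeiler1978, §2] -/
theorem stub_centring :
    ∀ (G : Type) [Group G] [TopologicalSpace G] [IsTopologicalGroup G] [CompactSpace G], Literature.MathematicalPhysics.QuantumFieldTheory.IsCompactSimpleLieGroup G → letI : MeasurableSpace G := borel G; haveI : BorelSpace G := ⟨rfl⟩; ∀ (r : Literature.MathematicalPhysics.QuantumFieldTheory.LatticeRep G), let St : ℕ → ℕ → Type := fun S T => Literature.MathematicalPhysics.QuantumFieldTheory.FinTorusSite S S S T; let Cfg : ℕ → ℕ → Type := fun S T => Literature.MathematicalPhysics.QuantumFieldTheory.FinTorusSite S S S T × Fin 4 → G; let cc : (n : ℕ) → Fin n → ℤ := fun n i => if 2 * i.val < n then (i.val : ℤ) else (i.val : ℤ) - n; let posE : (S T : ℕ) → St S T → EuclideanSpace ℝ (Fin 4) := fun S T x => Literature.MathematicalPhysics.QuantumLattice.siteToE (d := 4) ![cc T x.2.2.2, cc S x.1, cc S x.2.1, cc S x.2.2.1]; let P : (S T : ℕ) → St S T → Fin 4 → Fin 4 → Cfg S T → ℝ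 := fun _ _ x i j U => (r.ρ (Literature.MathematicalPhysics.QuantumFieldTheory.finTorusPlaquette U x i j)).trace.re; let A : (S T : ℕ) → St S T → Cfg S T → ℝ := fun S T x U => ∑ q : {q : Fin 4 × Fin 4 // q.1 < q.2}, P S T x q.1.1 q.1.2 U; let w : ℝ → (S T : ℕ) → Cfg S T → ℝ := fun β S T U => Real.exp (-β * ∑ x : St S T, ∑ q : {q : Fin 4 × Fin 4 // q.1 < q.2}, ((r.N : ℝ) - P S T x q.1.1 q.1.2 U)); let E : ℝ → (S T : ℕ) → (Cfg S T → ℝ) → ℝ := fun β S T F => (∫ U : Literature.MathematicalPhysics.QuantumFieldTheory.FinTorusSite S S S T × Fin 4 → G, F U * w β S T U ∂MeasureTheory.Measure.pi (fun _ => Literature.MathematicalPhysics.QuantumFieldTheory.haarProbability G)) / Literature.MathematicalPhysics.QuantumFieldTheory.wilsonFinTorusPartition r.ρ β S S S T; let Cov : ℝ → (S T : ℕ) → (Cfg S T → ℝ) → (Cfg S T → ℝ) → ℝ := fun β S T F F' => E β S T (fun U => F U * F' U) - E β S T F * E β S T F'; let refl : (S T : ℕ) → Cfg S T → Cfg S T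 := fun _ T U e => if e.2 = Fin.last 3 then (U ((e.1.1, e.1.2.1, e.1.2.2.1, Fin.rev e.1.2.2.2), Fin.last 3))⁻¹ else U ((e.1.1, e.1.2.1, e.1.2.2.1, ⟨(T - e.1.2.2.2.val) % T, Nat.mod_lt _ e.1.2.2.2.pos⟩), e.2); let B : (S T : ℕ) → ℝ → SchwartzMap (EuclideanSpace ℝ (Fin 4)) ℝ → Cfg S T → ℝ := fun S T s f U => ∑ x : St S T, f (s • posE S T x) * A S T x U; let Qrp : ℝ → (S T : ℕ) → ℝ → SchwartzMap (EuclideanSpace ℝ (Fin 4)) ℝ → ℝ := fun β S T s f => Cov β S T (fun U => B S T s f (refl S T U)) (B S T s f); let pur : ℝ → (S T : ℕ) → ℝ := fun β S T => Literature.MathematicalPhysics.QuantumFieldTheory.wilsonFinTorusPartition r.ρ β S S S (2 * T) / Literature.MathematicalPhysics.QuantumFieldTheory.wilsonFinTorusPartition r.ρ β S S S T ^ 2; ∀ (β : ℝ) (S P P' : ℕ) (s : ℝ) (v : SchwartzMap (EuclideanSpace ℝ (Fin 4)) ℝ), E β S P' (fun U => (B S P' s v (refl S P' U) - E β S P (B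 S P s v)) * (B S P' s v U - E β S P (B S P s v))) = Qrp β S P' s v + (E β S P' (B S P' s v) - E β S P (B S P s v)) ^ 2 :=
  Summit.QuantumFields.YangMills.Theorems.ThermalDescentReflection.thermalDescent_shortCentring

/-- **Registered stub `stub_spectral` of crux 26517 (S/M)**: `0 < λ₀`, `λ₀^T' ≤ Z(S,T')`, `Z(S,2T) ≤ λ₀^T Z(S,T)` from the trace formula;
= `ThermalDescent.SpectralBounds` (27309) verbatim, proved in the tree. [cite: MontvayMunster1994, §1.5] -/
theorem stub_spectral :
    ∀ (G : Type) [Group G] [TopologicalSpace G] [IsTopologicalGroup G] [CompactSpace G], Literature.MathematicalPhysics.QuantumFieldTheory.IsCompactSimpleLieGroup G → letI : MeasurableSpace G := borel G; haveI : BorelSpace G := ⟨rfl⟩; ∀ (r : Literature.MathematicalPhysics.QuantumFieldTheory.LatticeRep G) (β : ℝ) (S : ℕ) [NeZero S] (T T' : ℕ), 0 ≤ β → 2 ≤ T → T ≤ T' → 0 < Literature.MathematicalPhysics.QuantumFieldTheory.transferSpectralRadius r.ρ β S ∧ Literature.MathematicalPhysics.QuantumFieldTheory.transferSpectralRadius r.ρ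 β S ^ T' ≤ Literature.MathematicalPhysics.QuantumFieldTheory.wilsonFinTorusPartition r.ρ β S S S T' ∧ Literature.MathematicalPhysics.QuantumFieldTheory.wilsonFinTorusPartition r.ρ β S S S (2 * T) ≤ Literature.MathematicalPhysics.QuantumFieldTheory.transferSpectralRadius r.ρ β S ^ T * Literature.MathematicalPhysics.QuantumFieldTheory.wilsonFinTorusPartition r.ρ β S S S T :=
  Summit.QuantumFields.YangMills.Theorems.thermalDescent_spectralBounds

/-- **`PeriodDescent` (ThermalDescent copy) modulo the ONE open stub `stub_hsTransfer`** (= `ThermalDescent.HsTransfer`, 27307): the proved glue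
`thermalDescent_periodDescentGlue` fed with the two landed children. [cite: OsterwalderSeiler1978, §2] -/
theorem periodDescent_of_hsTransfer (h : Summit.QuantumFields.YangMills.Theses.ThermalDescent.HsTransfer) :
    Summit.QuantumFields.YangMills.Theses.ThermalDescent.PeriodDescent :=
  Summit.QuantumFields.YangMills.Theorems.thermalDescent_periodDescentGlue h
    Summit.QuantumFields.YangMills.Theorems.ThermalDescentReflection.thermalDescent_shortCentring
    Summit.QuantumFields.YangMills.Theorems.thermalDescent_spectralBounds

/-- **`PeriodDescent` (SqueezedSkewness copy, the live route's shared item 26517) modulo `stub_hsTransfer`** — the two route declarations have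
identical bodies. [cite: OsterwalderSeiler1978, §2] -/
theorem squeezedSkewness_periodDescent_of_hsTransfer (h : Summit.QuantumFields.YangMills.Theses.ThermalDescent.HsTransfer) :
    Summit.QuantumFields.YangMills.Theses.SqueezedSkewness.PeriodDescent :=
  periodDescent_of_hsTransfer h

end Summit.QuantumFields.YangMills.Theorems.SqueezedSkewnessPeriodDescentStubs
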